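import Summits.SmoothPoincare4.SmoothPoincare4.Theorems.ConvexBisectionAcyclicBisectionExistsChartRegularity
import Summits.SmoothPoincare4.SmoothPoincare4.Theorems.ConvexBisectionAcyclicBisectionExistsPicardLefschetzChart
import Literature.Geometry.Symplectic.BoundaryChartImmersion
import Literature.Topology.FourManifolds.KnotFraming
import HarnessLib

/-!
# The core of an oriented annulus chart of a page is a smoothly embedded curve of `Base g`
(wave 6, brick G6-9 — (R-BASE)/(R-EMB) for node N3a `node_STcurve` of stub `stub_STgeo` = NF4 N3, line
`modp-braid-orbits`, crux `ConvexBisection.AcyclicBisectionExists`, item stmt-SmoothPoincare4-10508;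
registered sub-goal `helper_isSmoothEmbedding_core`)

For a chart `φ : ℝ × ℝ → Base g` of a page with the N1a clauses (smooth, `1`-periodic, core
`φ (u, 0) = b (circlePt u)`, page-valued, injective on `[0,1) × (−1,1)`, positively oriented) the core
`b : 𝕊¹ → Base g` is a `C^∞` EMBEDDING in Mathlib's sense `Manifold.IsSmoothEmbedding (𝓡 1) (𝓡∂ 4) ∞ b`
(**`isSmoothEmbedding_core`**, registered `helper_isSmoothEmbedding_core`).  Since the curve lies in the
boundary of the manifold with boundary `Base g`, the immersion property is read through the half-slice
boundary charts of the regular sublevel `Base g = {rho ≤ 1/4}` with the tree's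
`isImmersionAtOfComplement_through_chart_of_injective_mfderiv` (`BoundaryChartImmersion.lean`): in the
chart `Θ` at `b z` the `0`-th coordinate of the page vanishes (`RegularSublevel.datum_apply_zero_eq_zero`),
so `b = Θ⁻¹ (0, g)` with `g = proj3 ∘ Θ ∘ b = (proj3 ∘ Θ ∘ φ(·,0)) ∘ ang` (`ang = angA` or `angB`, a local
smooth angle), whose differential is injective because `∂ᵤ φ ≠ 0` (orientation clause,
`injective_fderiv_of_chart`), `dΘ` is invertible and tangent vectors of the boundary have vanishing
`0`-th coordinate.  With Y4's charted chain (`helper_exists_charted_chain g 1`) this supplies the base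
curve (R-BASE) of the corrected route to N3a (`helper_STcurve_of_eCurves`): the core `b 0` of class
`chainVec g 0`.  Everything is proved; no definitions, no named facts, no `sorry`.  Reference: J. M. Lee,
*Introduction to Smooth Manifolds* (2013), Prop. 5.22, Thm. 5.48 [LeeSmoothManifolds2013]. [folklore]
-/

noncomputable section

set_option linter.dupNamespace false

open scoped Manifold ContDiff Topology
open Set Function Metric Filter
open Literature.Topology.FourManifolds Literature.Topology.FourManifolds.LefschetzBase
  Literature.Geometry.Symplectic.LegendrianDarboux

namespace Summit.SmoothPoincare4.SmoothPoincare4.Theorems.AcyclicBisectionExists.ModpBraidOrbits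

variable {g : ℕ} {c : ℂ} {φ : ℝ × ℝ → Base g} {b : Metric.sphere (0 : EuclideanSpace ℝ (Fin 2)) 1 → Base g}

/-! ## §1 Smoothness and injectivity of the core -/

/-- The core restricted to angles is smooth: `t ↦ φ (t, 0)`. [folklore] -/
theorem contMDiff_chart_zero (hφs : ContMDiff 𝓘(ℝ, ℝ × ℝ) (𝓡∂ 4) ∞ φ) :
    ContMDiff 𝓘(ℝ, ℝ) (𝓡∂ 4) ∞ fun t : ℝ => φ (t, 0) :=
  hφs.comp (contDiff_id.prodMk contDiff_const).contMDiff

/-- **The core of a chart is smooth** (`b = φ (·, 0) ∘ angA` and `∘ angB`). [folklore] -/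
theorem contMDiff_core (hφs : ContMDiff 𝓘(ℝ, ℝ × ℝ) (𝓡∂ 4) ∞ φ) (hφb : ∀ u, φ (u, 0) = b (circlePt u)) :
    ContMDiff (𝓡 1) (𝓡∂ 4) ∞ b := by
  intro z
  by_cases hz : z = ptA
  · have hfun : b = fun u => φ (angB u, 0) := funext fun u => by rw [hφb, circlePt_angB]
    rw [hfun]
    exact (contMDiff_chart_zero hφs).contMDiffAt.comp z (contMDiffAt_angB (hz ▸ ptA_ne_ptB))
  · have hfun : b = fun u => φ (angA u, 0) := funext fun u => by rw [hφb, circlePt_angA]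
    rw [hfun]
    exact (contMDiff_chart_zero hφs).contMDiffAt.comp z (contMDiffAt_angA hz)

/-- **The core of a chart is injective.** [folklore] -/
theorem injective_core (hφ1 : ∀ u r, φ (u + 1, r) = φ (u, r)) (hφb : ∀ u, φ (u, 0) = b (circlePt u))
    (hφi : InjOn φ (Ico (0 : ℝ) 1 ×ˢ Ioo (-1 : ℝ) 1)) : Injective b := by
  intro z z' h
  rw [← circlePt_angA z, ← circlePt_angA z', ← hφb, ← hφb] at h
  have h0 : (0 : ℝ) ∈ Ioo (-1 : ℝ) 1 := ⟨by norm_num, by norm_num⟩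
  obtain ⟨-, n, hn⟩ := chart_eq_iff hφ1 hφi (p := (angA z, 0)) (p' := (angA z', 0)) h0 h0 h
  rw [← circlePt_angA z, ← circlePt_angA z', circlePt_eq_circlePt_iff]
  exact ⟨-n, by simp only at hn; rw [hn]; push_cast; ring⟩

/-! ## §2 The immersion property through the boundary charts -/

/-- A continuous linear map from `ℝ` is injective iff it does not kill `1`. [folklore] -/
theorem injective_clm_real {F : Type*} [NormedAddCommGroup F] [NormedSpace ℝ F] {L : ℝ →L[ℝ] F}
    (hL : L 1 ≠ 0) : Injective L := by
  intro v w h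
  have hv : L v = v • L 1 := by rw [← L.map_smul, smul_eq_mul, mul_one]
  have hw : L w = w • L 1 := by rw [← L.map_smul, smul_eq_mul, mul_one]
  rw [hv, hw, ← sub_eq_zero, ← sub_smul, smul_eq_zero] at h
  exact sub_eq_zero.1 (h.resolve_right hL)

/-- A vector of `ℝ⁴` with vanishing `0`-th coordinate and vanishing `proj3` vanishes. [folklore] -/
theorem eq_zero_of_proj3_eq_zero {v : EuclideanSpace ℝ (Fin 4)} (h0 : v 0 = 0) (h : proj3 v = 0) : v = 0 := by
  rw [← L3_proj3 h0, h, map_zero]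

/-- **The core of an oriented annulus chart of a page is an immersion at every point.** [folklore] -/
theorem isImmersionAtOfComplement_core (hc : ‖c‖ = 1) (hφs : ContMDiff 𝓘(ℝ, ℝ × ℝ) (𝓡∂ 4) ∞ φ)
    (hφb : ∀ u, φ (u, 0) = b (circlePt u)) (hφp : ∀ p, φ p ∈ page g c)
    (hφo : ∀ u r, r ∈ Ioo (-1 : ℝ) 1 →
      0 < inner ℝ (deriv (fun r' => (φ (u, r')).1) r) (cplxJ (deriv (fun u' => (φ (u', r)).1) u)))
    (z : Metric.sphere (0 : EuclideanSpace ℝ (Fin 2)) 1) :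
    Manifold.IsImmersionAtOfComplement (EuclideanSpace ℝ (Fin 3)) (𝓡 1) (𝓡∂ 4) ∞ b z := by
  -- a local smooth angle `ang` with `circlePt ∘ ang = id`
  obtain ⟨ang, hang, hsec⟩ : ∃ ang : Metric.sphere (0 : EuclideanSpace ℝ (Fin 2)) 1 → ℝ,
      ContMDiffAt (𝓡 1) 𝓘(ℝ, ℝ) ∞ ang z ∧ ∀ u, circlePt (ang u) = u := by
    by_cases hz : z = ptA
    · exact ⟨angB, contMDiffAt_angB (hz ▸ ptA_ne_ptB), circlePt_angB⟩
    · exact ⟨angA, contMDiffAt_angA hz, circlePt_angA⟩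
  have hbang : ∀ u, b u = φ (ang u, 0) := fun u => by rw [hφb, hsec]
  -- the boundary chart at `p = b z`
  set p : Base g := b z with hp
  set D := (RegularSublevel.halfSliceAtlas (isRegularLevel_rho g)).datum p with hD
  have hext : extChartAt (𝓡∂ 4) p = (D.chart p).extend (𝓡∂ 4) := rfl
  have hsrc : ∀ q : Base g, q.1 ∈ D.Θ.source → q ∈ (D.chart p).source := fun q hq => hq
  have hpsrc : p.1 ∈ D.Θ.source := (RegularSublevel.halfSliceAtlas (isRegularLevel_rho g)).mem_source p
  have hrho : ∀ u, rho g (b u).1 = 1 / 4 := fun u => by rw [hbang]; exact rho_eq_of_mem_page g hc (hφp _)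
  have hzero : ∀ q : Base g, q.1 ∈ D.Θ.source → rho g q.1 = 1 / 4 → D.Θ q.1 0 = 0 := fun q hq hr =>
    RegularSublevel.datum_apply_zero_eq_zero (isRegularLevel_rho g) p hq hr
  -- continuity and smoothness of the core
  have hbs : ContMDiff (𝓡 1) (𝓡∂ 4) ∞ b := contMDiff_core hφs hφb
  have hbc : Continuous b := hbs.continuous
  -- the open set where the core is in the chart source
  set U : Set (Metric.sphere (0 : EuclideanSpace ℝ (Fin 2)) 1) := {u | (b u).1 ∈ D.Θ.source} with hU
  have hUo : IsOpen U := D.Θ.open_source.preimage (continuous_subtype_val.comp hbc)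
  have hzU : z ∈ U := hpsrc
  -- the hyperplane map `gg = proj3 ∘ Θ ∘ b`
  set gg : Metric.sphere (0 : EuclideanSpace ℝ (Fin 2)) 1 → EuclideanSpace ℝ (Fin 3) :=
    fun u => proj3 (D.Θ (b u).1) with hgg
  -- smoothness of `gg` on `U`
  have hΘ : ContMDiffOn (𝓡 4) 𝓘(ℝ, EuclideanSpace ℝ (Fin 4)) ∞ D.Θ D.Θ.source := D.contMDiffOn_toFun
  have hvalb : ContMDiff (𝓡 1) (𝓡 4) ∞ fun u => (b u).1 :=
    (RegularSublevel.contMDiff_incl (isRegularLevel_rho g)).comp hbs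
  have hg : ContMDiffOn (𝓡 1) 𝓘(ℝ, EuclideanSpace ℝ (Fin 3)) ∞ gg U :=
    proj3.contMDiff.comp_contMDiffOn (hΘ.comp hvalb.contMDiffOn fun u hu => hu)
  -- the local formula and the target membership
  have hmem : ∀ᶠ u in 𝓝 z, (0 : EuclideanSpace ℝ (Fin 4)) + L3 (gg u) ∈ (extChartAt (𝓡∂ 4) p).target := by
    filter_upwards [hUo.mem_nhds hzU] with u hu
    rw [zero_add, hgg]
    dsimp only
    rw [L3_proj3 (hzero (b u) hu (hrho u)), hext, ← D.extend_chart_apply (hsrc _ hu)]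
    exact PartialEquiv.map_source _ (by rw [OpenPartialHomeomorph.extend_source]; exact hsrc _ hu)
  have hf : b =ᶠ[𝓝 z] fun u => (extChartAt (𝓡∂ 4) p).symm ((0 : EuclideanSpace ℝ (Fin 4)) + L3 (gg u)) := by
    filter_upwards [hUo.mem_nhds hzU] with u hu
    rw [zero_add, hgg]
    dsimp only
    rw [L3_proj3 (hzero (b u) hu (hrho u)), hext, ← D.extend_chart_apply (hsrc _ hu)]
    exact (PartialEquiv.left_inv _ (by rw [OpenPartialHomeomorph.extend_source]; exact hsrc _ hu)).symm
  -- injectivity of the differential of `gg` at `z`: `gg = G ∘ ang`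
  set Φ₀ : ℝ → EuclideanSpace ℝ (Fin 4) := fun t => (φ (t, 0)).1 with hΦ₀
  set G : ℝ → EuclideanSpace ℝ (Fin 3) := fun t => proj3 (D.Θ (Φ₀ t)) with hG
  have hggG : gg = G ∘ ang := funext fun u => by
    simp only [hgg, hG, hΦ₀, comp_apply, hbang]
  have hΦ₀s : ContDiff ℝ ∞ Φ₀ := (contDiff_val_of_chart hφs).comp (contDiff_id.prodMk contDiff_const)
  have ht₀ : Φ₀ (ang z) = p.1 := by simp only [hΦ₀, hp, hbang]
  -- `Θ` is differentiable at `p.1` with injective differential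
  have hΘd : ContDiffAt ℝ ∞ D.Θ p.1 := by
    have h := (contMDiffOn_iff_contDiffOn.1 hΘ).contDiffAt (D.Θ.open_source.mem_nhds hpsrc)
    exact h
  have hΘsd : ContDiffAt ℝ ∞ D.Θ.symm (D.Θ p.1) :=
    (contMDiffOn_iff_contDiffOn.1 D.contMDiffOn_symm).contDiffAt (D.Θ.open_target.mem_nhds (D.Θ.map_source hpsrc))
  have hΘinj : Injective (fderiv ℝ D.Θ p.1) := by
    have hcomp : (fderiv ℝ D.Θ.symm (D.Θ p.1)).comp (fderiv ℝ D.Θ p.1) = ContinuousLinearMap.id ℝ _ := by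
      have h1 : HasFDerivAt (D.Θ.symm ∘ D.Θ) ((fderiv ℝ D.Θ.symm (D.Θ p.1)).comp (fderiv ℝ D.Θ p.1)) p.1 :=
        (hΘsd.differentiableAt (by simp)).hasFDerivAt.comp p.1 (hΘd.differentiableAt (by simp)).hasFDerivAt
      have h2 : HasFDerivAt (D.Θ.symm ∘ D.Θ) (ContinuousLinearMap.id ℝ _) p.1 :=
        (hasFDerivAt_id p.1).congr_of_eventuallyEq (by
          filter_upwards [D.Θ.open_source.mem_nhds hpsrc] with y hy
          exact D.Θ.left_inv hy)
      exact h1.unique h2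
    intro v w hvw
    have h := congrArg (fun L : EuclideanSpace ℝ (Fin 4) →L[ℝ] EuclideanSpace ℝ (Fin 4) => L (v - w)) hcomp
    simp only [ContinuousLinearMap.coe_comp, comp_apply, map_sub, hvw, sub_self,
      ContinuousLinearMap.id_apply] at h
    exact sub_eq_zero.1 h.symm
  -- the velocity `V = ∂ᵤ φ (ang z, 0) ≠ 0`
  set V : EuclideanSpace ℝ (Fin 4) := fderiv ℝ (fun q : ℝ × ℝ => (φ q).1) (ang z, 0) ((1 : ℝ), (0 : ℝ)) with hV
  have hV0 : V ≠ 0 := by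
    intro h
    have hi := injective_fderiv_of_chart hφs hφo (u := ang z) (r := 0) ⟨by norm_num, by norm_num⟩
    have h2 : fderiv ℝ (fun q : ℝ × ℝ => (φ q).1) (ang z, 0) ((1 : ℝ), (0 : ℝ)) =
        fderiv ℝ (fun q : ℝ × ℝ => (φ q).1) (ang z, 0) ((0 : ℝ), (0 : ℝ)) := by
      rw [← hV, h, show ((0 : ℝ), (0 : ℝ)) = (0 : ℝ × ℝ) from rfl, map_zero]
    have h3 := hi h2
    simp at h3
  have hΦ₀d : HasDerivAt Φ₀ V (ang z) := hasDerivAt_val_u hφs (ang z) 0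
  -- the derivative of `Θ ∘ Φ₀` and its `0`-th coordinate
  set W : EuclideanSpace ℝ (Fin 4) := fderiv ℝ D.Θ p.1 V with hW
  have hΘΦ : HasDerivAt (fun t => D.Θ (Φ₀ t)) W (ang z) := by
    have hΘd' : DifferentiableAt ℝ D.Θ (Φ₀ (ang z)) := by
      rw [ht₀]; exact hΘd.differentiableAt (by simp)
    have h := hΘd'.hasFDerivAt.comp_hasDerivAt (ang z) hΦ₀d
    rw [ht₀] at h
    exact h
  have hW0 : W 0 = 0 := by
    -- the `0`-th coordinate of `Θ ∘ Φ₀` vanishes near `ang z`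
    have hnear : ∀ᶠ t in 𝓝 (ang z), D.Θ (Φ₀ t) 0 = 0 := by
      have hc' : ContinuousAt Φ₀ (ang z) := hΦ₀s.continuous.continuousAt
      filter_upwards [hc'.preimage_mem_nhds (D.Θ.open_source.mem_nhds (by rw [ht₀]; exact hpsrc))] with t ht
      exact hzero (φ (t, 0)) ht (rho_eq_of_mem_page g hc (hφp _))
    set π0 : EuclideanSpace ℝ (Fin 4) →L[ℝ] ℝ := EuclideanSpace.proj (0 : Fin 4) with hπ0
    have hπ : ∀ v : EuclideanSpace ℝ (Fin 4), π0 v = v 0 := fun v => rfl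
    have h1 : HasDerivAt (fun t => π0 (D.Θ (Φ₀ t))) (π0 W) (ang z) :=
      π0.hasFDerivAt.comp_hasDerivAt (ang z) hΘΦ
    have h2 : HasDerivAt (fun t => π0 (D.Θ (Φ₀ t))) 0 (ang z) := by
      refine (hasDerivAt_const (ang z) (0 : ℝ)).congr_of_eventuallyEq ?_
      filter_upwards [hnear] with t ht
      rw [hπ, ht]
    rw [← hπ]
    exact h1.unique h2
  have hWne : W ≠ 0 := fun h => hV0 (hΘinj (by rw [← hW, h, map_zero]))
  have hGd : HasDerivAt G (proj3 W) (ang z) := proj3.hasFDerivAt.comp_hasDerivAt (ang z) hΘΦ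
  have hGne : proj3 W ≠ 0 := fun h => hWne (eq_zero_of_proj3_eq_zero hW0 h)
  -- injectivity of `mfderiv gg z`
  have hinj : Injective (mfderiv (𝓡 1) 𝓘(ℝ, EuclideanSpace ℝ (Fin 3)) gg z) := by
    rw [hggG]
    have hangd : MDifferentiableAt (𝓡 1) 𝓘(ℝ, ℝ) ang z := hang.mdifferentiableAt (by simp)
    have hGmd : MDifferentiableAt 𝓘(ℝ, ℝ) 𝓘(ℝ, EuclideanSpace ℝ (Fin 3)) G (ang z) :=
      hGd.differentiableAt.mdifferentiableAt
    rw [mfderiv_comp z hGmd hangd]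
    -- `mfderiv ang z` is injective: `circlePt ∘ ang = id`
    have hanginj : Injective (mfderiv (𝓡 1) 𝓘(ℝ, ℝ) ang z) := by
      have hcd : MDifferentiableAt 𝓘(ℝ, ℝ) (𝓡 1) circlePt (ang z) :=
        contMDiff_circlePt.contMDiffAt.mdifferentiableAt (by simp)
      have h1 : mfderiv (𝓡 1) (𝓡 1) (circlePt ∘ ang) z =
          (mfderiv 𝓘(ℝ, ℝ) (𝓡 1) circlePt (ang z)).comp (mfderiv (𝓡 1) 𝓘(ℝ, ℝ) ang z) :=
        mfderiv_comp z hcd hangd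
      have h2 : circlePt ∘ ang = id := funext hsec
      rw [h2, mfderiv_id] at h1
      intro v w hvw
      have hv := ContinuousLinearMap.ext_iff.1 h1 v
      have hw := ContinuousLinearMap.ext_iff.1 h1 w
      simp only [ContinuousLinearMap.coe_id', id_eq] at hv hw
      exact hv.trans ((congrArg (mfderiv 𝓘(ℝ, ℝ) (𝓡 1) circlePt (ang z)) hvw).trans hw.symm)
    -- `mfderiv G (ang z) = fderiv G (ang z)` is injective
    have hGinj : Injective (fderiv ℝ G (ang z)) := by
      refine injective_clm_real ?_
      rw [fderiv_apply_one_eq_deriv, hGd.deriv]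
      exact hGne
    rw [mfderiv_eq_fderiv]
    exact hGinj.comp hanginj
  exact isImmersionAtOfComplement_through_chart_of_injective_mfderiv (p := p) (y₀ := 0) rfl hUo hzU hg hinj
    hmem hf

/-- **The core of an oriented annulus chart of a page is a smoothly embedded curve of `Base g`.**
[cite: LeeSmoothManifolds2013, Prop. 5.22] -/
theorem isSmoothEmbedding_core (hc : ‖c‖ = 1) (hφs : ContMDiff 𝓘(ℝ, ℝ × ℝ) (𝓡∂ 4) ∞ φ)
    (hφ1 : ∀ u r, φ (u + 1, r) = φ (u, r)) (hφb : ∀ u, φ (u, 0) = b (circlePt u))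
    (hφp : ∀ p, φ p ∈ page g c) (hφi : InjOn φ (Ico (0 : ℝ) 1 ×ˢ Ioo (-1 : ℝ) 1))
    (hφo : ∀ u r, r ∈ Ioo (-1 : ℝ) 1 →
      0 < inner ℝ (deriv (fun r' => (φ (u, r')).1) r) (cplxJ (deriv (fun u' => (φ (u', r)).1) u))) :
    Manifold.IsSmoothEmbedding (𝓡 1) (𝓡∂ 4) ∞ b :=
  ⟨⟨EuclideanSpace ℝ (Fin 3), inferInstance, inferInstance,
      fun z => isImmersionAtOfComplement_core hc hφs hφb hφp hφo z⟩,
    ((contMDiff_core hφs hφb).continuous.isClosedEmbedding (injective_core hφ1 hφb hφi)).isEmbedding⟩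

/-! ## The registered form -/

/-- **Sub-goal `helper_isSmoothEmbedding_core`** (G6-9, (R-EMB) for node N3a): the core of an
oriented annulus chart of a page (N1a clauses) is a smooth embedding `𝕊¹ → Base g`.
[cite: LeeSmoothManifolds2013, Prop. 5.22] -/
theorem helper_isSmoothEmbedding_core : ∀ (g : ℕ) (c : ℂ) (φ : ℝ × ℝ → Literature.Topology.FourManifolds.LefschetzBase.Base g) (b : Metric.sphere (0 : EuclideanSpace ℝ (Fin 2)) 1 → Literature.Topology.FourManifolds.LefschetzBase.Base g), ‖c‖ = 1 → ContMDiff 𝓘(ℝ, ℝ × ℝ) (𝓡∂ 4) ∞ φ → (∀ u r, φ (u + 1, r) = φ (u, r)) → (∀ u, φ (u, 0) = b (Literature.Topology.FourManifolds.circlePt u)) → (∀ p, φ p ∈ Literature.Topology.FourManifolds.LefschetzBase.page g c) → Set.InjOn φ (Set.Ico (0 : ℝ) 1 ×ˢ Set.Ioo (-1 : ℝ) 1) → (∀ u r, r ∈ Set.Ioo (-1 : ℝ) 1 → 0 < inner ℝ (deriv (fun r' => (φ (u, r')).1) r) (Literature.Topology.FourManifolds.LefschetzBase.cplxJ (deriv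 (fun u' => (φ (u', r)).1) u))) → Manifold.IsSmoothEmbedding (𝓡 1) (𝓡∂ 4) ∞ b :=
  fun _ _ _ _ hc hφs hφ1 hφb hφp hφi hφo => isSmoothEmbedding_core hc hφs hφ1 hφb hφp hφi hφo

end Summit.SmoothPoincare4.SmoothPoincare4.Theorems.AcyclicBisectionExists.ModpBraidOrbits

end
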